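import Summits.RiemannHypothesis.RiemannHypothesis.Theorems.SoninPolyTraceSum
import HarnessLib

/-!
# The twisted Sonin trace form of a polynomial section vector, III: evaluator primitives

Cell `rh-explicit`, seat cc-s2-1 (sub-line (ii), S = {∞, 2}).  Kernel-evaluable, gcd-free building blocks for the
certified lower bound `Blo ≤ B` (parts IV–V): by parts I–II, `B = Σ_j WN_j·I(−(2j+1)) − Σ_i WP_i·I(2i+1)` with `I(z)` an
explicit combination of `e^{±zL/2}`, `e^{−L/2}` (`L = log 2`), `e^{zb}` and the values `Q_z(0)`, `Q_z(2b)`, `Q_z(L)` of a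
certificate antiderivative `Q_z` (`(z/2)Q_z + Q_z′ = κ`, Boolean `antiderivOK`).  Here:
* the certificate antiderivatives by an INTEGER recurrence (`kapDen`, `kapInt`, `sAux`, `sList`): writing `κ_k = K_k/Dκ`
  and `Q_k = 2 s_k/(Dκ z^{D+1−k})`, the ODE becomes `s_k = z^{D−k}K_k − 2(k+1)s_{k+1}`, so `Q_z(u) = c_z·P_s(zu)` with
  `P_s = Σ s_k t^k` an integer polynomial (`twistZ`, `qconst`, `antiderivQ`, `ev_antiderivQ`); the recurrence is not
  proved — `antiderivQ` is re-checked by `antiderivOK` in part IV;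
* integer Horner at an interval (`evZ`, `evZQ`, `hornerZ`, `mem_hornerZ`) and the three value enclosures `valL ∋ Q_z(L)`,
  `val2b ∋ Q_z(2b)` (exact), `val0 ∋ Q_z(0)` (exact) with their inclusion lemmas;
* the weights `WN_k`, `WP_k` as inner sums over the coefficient list with running powers (`inN`, `inP`, `inNQ`, `inPQ`,
  `wnMI`, `wpMI`, `mem_wnMI`, `mem_wpMI`) — no rational normalisation and no list look-ups inside the kernel loop;
* the small helpers `scaleQ`, `ofQ`.
All in the tree's fixed-point interval arithmetic `NumericsMP.MI` (`mem_ofFrac/add/mul/mulInt/divNat`).  Definitions are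
certificate bookkeeping; no facts, no axioms.
-/

set_option linter.dupNamespace false  -- the mandated namespace repeats `RiemannHypothesis`

noncomputable section

open MeasureTheory Set Finset
open scoped Real
open Summit.RiemannHypothesis.RiemannHypothesis.Theorems.SemilocalPolyWitness
open Summit.RiemannHypothesis.RiemannHypothesis.SoninCert (derivL)
open Literature.NumberTheory.LFunctions Literature.NumberTheory.ConnesConsani2021
open Literature.Analysis.ValidatedNumerics Literature.Analysis.ValidatedNumerics.NumericsMP

namespace Summit.RiemannHypothesis.RiemannHypothesis.SoninPoly

/-! ## Small interval helpers -/

/-- Scaling an interval by a rational `q = num/den` (outward). [folklore] -/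
def scaleQ (I : MI) (q : ℚ) : MI := (I.mulInt q.num).divNat q.den

/-- `x ∈ I ⇒ q·x ∈ scaleQ I q`. [folklore] -/
theorem mem_scaleQ {S : ℕ} {x : ℝ} {I : MI} (hx : MI.mem S x I) (q : ℚ) :
    MI.mem S ((q : ℝ) * x) (scaleQ I q) := by
  have h := MI.mem_divNat (MI.mem_mulInt hx q.num) (n := q.den) q.pos
  unfold scaleQ
  convert h using 2
  rw [Rat.cast_def]; ring

/-- A rational as an interval. [folklore] -/
def ofQ (S : ℕ) (q : ℚ) : MI := MI.ofFrac S q.num q.den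

/-- `q ∈ ofQ S q`. [folklore] -/
theorem mem_ofQ (S : ℕ) (q : ℚ) : MI.mem S ((q : ℚ) : ℝ) (ofQ S q) := by
  have h := MI.mem_ofFrac S q.num (q := q.den) q.pos
  unfold ofQ
  convert h using 2
  rw [Rat.cast_def]

/-! ## Integer-coefficient polynomials (`evZ`, `hornerZ`) -/

/-- Horner evaluation of an INTEGER coefficient list at a real point. [folklore] -/
noncomputable def evZ : List ℤ → ℝ → ℝ
  | [], _ => 0
  | a :: as, x => (a : ℝ) + x * evZ as x

/-- Horner evaluation of an integer list at a rational point (kernel-computable, exact). [folklore] -/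
def evZQ : List ℤ → ℚ → ℚ
  | [], _ => 0
  | a :: as, x => (a : ℚ) + x * evZQ as x

/-- `evZ` at a rational point is the cast of `evZQ`. [folklore] -/
theorem evZ_ratCast : ∀ (l : List ℤ) (q : ℚ), evZ l (q : ℝ) = ((evZQ l q : ℚ) : ℝ)
  | [], q => by simp [evZ, evZQ]
  | a :: as, q => by simp only [evZ, evZQ, evZ_ratCast as q]; push_cast; ring

/-- `evZ l 0` is the constant coefficient. [folklore] -/
theorem evZ_zero_eq_headD : ∀ (l : List ℤ), evZ l 0 = ((l.headD 0 : ℤ) : ℝ)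
  | [] => by simp [evZ]
  | a :: as => by simp [evZ]

/-- Horner evaluation of an integer list at an interval `T` (coefficients enter as exact scaled integers). [folklore] -/
def hornerZ (S : ℕ) : List ℤ → MI → MI
  | [], _ => MI.ofInt S 0
  | c :: l, T => (MI.ofInt S c).add (MI.mul S T (hornerZ S l T))

/-- **Inclusion for `hornerZ`**: `x ∈ T ⇒ evZ l x ∈ hornerZ S l T`. [folklore] -/
theorem mem_hornerZ {S : ℕ} (hS : 0 < S) {x : ℝ} {T : MI} (hx : MI.mem S x T) :
    ∀ l : List ℤ, MI.mem S (evZ l x) (hornerZ S l T)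
  | [] => by simpa [hornerZ, evZ] using MI.mem_ofInt S 0
  | c :: l => by
      rw [hornerZ]; simp only [evZ]
      exact MI.mem_add (MI.mem_ofInt S c) (MI.mem_mul hS hx (mem_hornerZ hS hx l))

/-! ## The certificate antiderivatives, by an INTEGER recurrence

For `(z/2)Q + Q′ = κ` write `κ_k = K_k/Dκ` over a common denominator and `Q_k = 2 s_k /(Dκ z^{D+1−k})`; then the
coefficient identity `(z/2)Q_k + (k+1)Q_{k+1} = κ_k` becomes the gcd-free integer recurrence
`s_k = z^{D−k} K_k − 2(k+1) s_{k+1}` (`s_{D+1} = 0`).  So `Q_z(u) = c_z · P_s(zu)` with `P_s(t) = Σ_k s_k t^k` an INTEGER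
polynomial and `c_z = 2/(Dκ z^{D+1})`: the kernel evaluates `P_s` (integer Horner at the interval `zΛ`, exact integer
Horner at the rational `2bz`) and never normalises a rational inside the loop.  The recurrence is not proved here: the
resulting rational list `antiderivQ` is re-checked against `κ` by `antiderivOK` (once, `antiderivsOK`). -/

/-- A common denominator of the list (an `lcm`; only its use through `antiderivOK` matters). [folklore] -/
def kapDen (κL : List ℚ) : ℕ := κL.foldl (fun d c => Nat.lcm d c.den) 1

/-- Integer numerators `K_k = κ_k · Dκ`. [folklore] -/
def kapInt (κL : List ℚ) : List ℤ := κL.map fun c => c.num * (((kapDen κL) / c.den : ℕ) : ℤ)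

/-- The integer recurrence `s_k = z^{D−k} K_k − 2(k+1) s_{k+1}` on the REVERSED numerator list (running power `zp`). [folklore] -/
def sAux (z : ℤ) : List ℤ → ℕ → ℤ → ℤ → List ℤ
  | [], _, _, _ => []
  | K :: Ks, k, zp, sprev =>
    let s := zp * K - 2 * ((k : ℤ) + 1) * sprev
    s :: sAux z Ks (k - 1) (zp * z) s

/-- `sList κL z = [s_0, …, s_D]`. [folklore] -/
def sList (κL : List ℚ) (z : ℤ) : List ℤ := (sAux z (kapInt κL).reverse (κL.length - 1) 1 0).reverse

/-- The rational list `k ↦ c_k · zp · z^k`. [folklore] -/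
def twistZ (z : ℤ) : ℤ → List ℤ → List ℚ
  | _, [] => []
  | zp, c :: cs => ((c * zp : ℤ) : ℚ) :: twistZ z (zp * z) cs

/-- The constant `c_z = 2/(Dκ z^{D+1})`. [folklore] -/
def qconst (κL : List ℚ) (z : ℤ) : ℚ := 2 / ((kapDen κL : ℚ) * (z : ℚ) ^ κL.length)

/-- `antiderivQ κL z` = the candidate antiderivative list `Q_k = c_z s_k z^k` for the exponent `z`. [folklore] -/
def antiderivQ (κL : List ℚ) (z : ℤ) : List ℚ := LQ.smul (qconst κL z) (twistZ z 1 (sList κL z))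

/-- `ev (twistZ z zp l) x = zp · evZ l (z x)`. [folklore] -/
theorem ev_twistZ (z : ℤ) (x : ℝ) : ∀ (l : List ℤ) (zp : ℤ), LQ.ev (twistZ z zp l) x = (zp : ℝ) * evZ l ((z : ℝ) * x)
  | [], zp => by simp [twistZ, evZ]
  | c :: cs, zp => by
      rw [twistZ, LQ.ev_cons, ev_twistZ z x cs (zp * z)]; simp only [evZ]; push_cast; ring

/-- **`Q_z(x) = c_z · P_s(z x)`**. [folklore] -/
theorem ev_antiderivQ (κL : List ℚ) (z : ℤ) (x : ℝ) :
    LQ.ev (antiderivQ κL z) x = ((qconst κL z : ℚ) : ℝ) * evZ (sList κL z) ((z : ℝ) * x) := by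
  rw [antiderivQ, LQ.ev_smul, ev_twistZ]; push_cast; ring


/-! ## The three value enclosures `Q_z(L)`, `Q_z(2b)`, `Q_z(0)` -/

variable (κL : List ℚ) in
/-- `Q_z(L) ∈ valL`: `c_z · P_s(zΛ)` (integer Horner at the interval `zΛ`). [folklore] -/
def valL (S : ℕ) (Λ : MI) (s : List ℤ) (z : ℤ) : MI := scaleQ (hornerZ S s (Λ.mulInt z)) (qconst κL z)

variable (κL : List ℚ) (b : ℚ) in
/-- `Q_z(2b) ∈ val2b`: `c_z · P_s(2bz)`, EXACT. [folklore] -/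
def val2b (S : ℕ) (s : List ℤ) (z : ℤ) : MI := ofQ S (qconst κL z * evZQ s ((z : ℚ) * (2 * b)))

variable (κL : List ℚ) in
/-- `Q_z(0) ∈ val0`: `c_z · s_0`, exact. [folklore] -/
def val0 (S : ℕ) (s : List ℤ) (z : ℤ) : MI := ofQ S (qconst κL z * ((s.headD 0 : ℤ) : ℚ))

/-- `Q_z(L) ∈ valL … (sList κL z) z` for `L = log 2 ∈ Λ`. [folklore] -/
theorem mem_valL {κL : List ℚ} {S : ℕ} (hS : 0 < S) {Λ : MI} (hΛ : MI.mem S (Real.log 2) Λ) (z : ℤ) :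
    MI.mem S (LQ.ev (antiderivQ κL z) (Real.log 2)) (valL κL S Λ (sList κL z) z) := by
  have := mem_scaleQ (mem_hornerZ hS (MI.mem_mulInt hΛ z) (sList κL z)) (qconst κL z)
  unfold valL
  rw [ev_antiderivQ]
  convert this using 2
  ring

/-- `Q_z(2b) ∈ val2b … (sList κL z) z`. [folklore] -/
theorem mem_val2b {κL : List ℚ} {b : ℚ} (S : ℕ) (z : ℤ) :
    MI.mem S (LQ.ev (antiderivQ κL z) (2 * (b : ℝ))) (val2b κL b S (sList κL z) z) := by
  have := mem_ofQ S (qconst κL z * evZQ (sList κL z) ((z : ℚ) * (2 * b)))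
  unfold val2b
  rw [ev_antiderivQ, show (z : ℝ) * (2 * (b : ℝ)) = (((z : ℚ) * (2 * b) : ℚ) : ℝ) by push_cast; ring, evZ_ratCast]
  convert this using 2
  push_cast; ring

/-- `Q_z(0) ∈ val0 … (sList κL z) z`. [folklore] -/
theorem mem_val0 {κL : List ℚ} (S : ℕ) (z : ℤ) : MI.mem S (LQ.ev (antiderivQ κL z) 0) (val0 κL S (sList κL z) z) := by
  have := mem_ofQ S (qconst κL z * (((sList κL z).headD 0 : ℤ) : ℚ))
  unfold val0
  rw [ev_antiderivQ, mul_zero, evZ_zero_eq_headD]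
  convert this using 2
  push_cast; ring

/-! ## The weights `WN_k`, `WP_k` -/

variable (r : List ℚ) (X : ℚ)

/-- Inner sum `Σ_j c_j X^{i+j}/(i+j+k+1)` over a coefficient SUFFIX `cs` (position `i`, running powers `xp = Xnum^i`,
`dp = Xden^i`), gcd-free terms, no list look-ups. [folklore] -/
def inN (S : ℕ) (k : ℕ) : ℕ → ℤ → ℕ → List ℚ → MI
  | _, _, _, [] => MI.ofInt S 0
  | i, xp, dp, c :: cs =>
    (MI.ofFrac S (c.num * xp) (c.den * dp * (i + k + 1))).add (inN S k (i + 1) (xp * X.num) (dp * X.den) cs)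

/-- Inner sum `Σ_j c_j/(i+j+k+1)` over a coefficient suffix. [folklore] -/
def inP (S : ℕ) (k : ℕ) : ℕ → List ℚ → MI
  | _, [] => MI.ofInt S 0
  | i, c :: cs => (MI.ofFrac S c.num (c.den * (i + k + 1))).add (inP S k (i + 1) cs)

/-- The exact inner sum `Σ_j c_j X^{i+j}/(i+j+k+1)`. [folklore] -/
def inNQ (k i : ℕ) (cs : List ℚ) : ℚ := ∑ j ∈ range cs.length, cs.getD j 0 * X ^ (i + j) / ((i : ℚ) + j + k + 1)

/-- The exact inner sum `Σ_j c_j/(i+j+k+1)`. [folklore] -/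
def inPQ (k i : ℕ) (cs : List ℚ) : ℚ := ∑ j ∈ range cs.length, cs.getD j 0 / ((i : ℚ) + j + k + 1)

/-- `inNQ` peels its first term. [folklore] -/
theorem inNQ_cons (k i : ℕ) (c : ℚ) (cs : List ℚ) :
    inNQ X k i (c :: cs) = c * X ^ i / ((i + k + 1 : ℕ) : ℚ) + inNQ X k (i + 1) cs := by
  unfold inNQ
  rw [List.length_cons, Finset.sum_range_succ']
  simp only [List.getD_cons_succ, List.getD_cons_zero, add_zero, Nat.cast_zero]
  rw [add_comm]
  congr 1
  · push_cast; ring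
  · refine Finset.sum_congr rfl fun j _ => ?_
    rw [show i + (j + 1) = i + 1 + j by ring]; push_cast; ring

/-- `inPQ` peels its first term. [folklore] -/
theorem inPQ_cons (k i : ℕ) (c : ℚ) (cs : List ℚ) :
    inPQ k i (c :: cs) = c / ((i + k + 1 : ℕ) : ℚ) + inPQ k (i + 1) cs := by
  unfold inPQ
  rw [List.length_cons, Finset.sum_range_succ']
  simp only [List.getD_cons_succ, List.getD_cons_zero, Nat.cast_zero]
  rw [add_comm]
  congr 1
  · push_cast; ring
  · refine Finset.sum_congr rfl fun j _ => ?_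
    push_cast; ring

/-- One gcd-free term `c·xp/(den·dp·m) ∋ c X^i/m` (`xp = Xnum^i`, `dp = Xden^i`). [folklore] -/
theorem mem_termN (S : ℕ) (c : ℚ) (i m : ℕ) (hm : 0 < m) :
    MI.mem S (((c * X ^ i / (m : ℚ) : ℚ) : ℝ)) (MI.ofFrac S (c.num * X.num ^ i) (c.den * X.den ^ i * m)) := by
  have hden : 0 < c.den * X.den ^ i * m := Nat.mul_pos (Nat.mul_pos c.pos (pow_pos X.pos i)) hm
  have h := MI.mem_ofFrac S (c.num * X.num ^ i) (q := c.den * X.den ^ i * m) hden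
  convert h using 1
  have e1 : ((c * X ^ i / (m : ℚ) : ℚ) : ℝ) = (c : ℝ) * (X : ℝ) ^ i / (m : ℝ) := by push_cast; ring
  rw [e1, Rat.cast_def c, Rat.cast_def X]
  have h1 : ((c.den : ℝ)) ≠ 0 := by exact_mod_cast c.pos.ne'
  have h3 : ((X.den : ℝ)) ≠ 0 := by exact_mod_cast X.pos.ne'
  have h4 : (m : ℝ) ≠ 0 := by exact_mod_cast hm.ne'
  push_cast
  rw [div_pow]
  field_simp

/-- One gcd-free term `c/(den·m) ∋ c/m`. [folklore] -/
theorem mem_termP (S : ℕ) (c : ℚ) (m : ℕ) (hm : 0 < m) :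
    MI.mem S (((c / (m : ℚ) : ℚ) : ℝ)) (MI.ofFrac S c.num (c.den * m)) := by
  have hden : 0 < c.den * m := Nat.mul_pos c.pos hm
  have h := MI.mem_ofFrac S c.num (q := c.den * m) hden
  convert h using 1
  have e1 : ((c / (m : ℚ) : ℚ) : ℝ) = (c : ℝ) / (m : ℝ) := by push_cast; ring
  rw [e1, Rat.cast_def c]
  have h1 : ((c.den : ℝ)) ≠ 0 := by exact_mod_cast c.pos.ne'
  have h4 : (m : ℝ) ≠ 0 := by exact_mod_cast hm.ne'
  push_cast
  field_simp

/-- `inNQ k i cs ∈ inN … i (Xnum^i) (Xden^i) cs`. [folklore] -/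
theorem mem_inN (S : ℕ) (k : ℕ) : ∀ (cs : List ℚ) (i : ℕ),
    MI.mem S ((inNQ X k i cs : ℚ) : ℝ) (inN X S k i (X.num ^ i) (X.den ^ i) cs)
  | [], i => by simpa [inN, inNQ] using MI.mem_ofInt S 0
  | c :: cs, i => by
      rw [inN, inNQ_cons]
      have ih := mem_inN S k cs (i + 1)
      rw [pow_succ, pow_succ] at ih
      have h1 := mem_termN X S c i (i + k + 1) (Nat.succ_pos _)
      have := MI.mem_add h1 ih
      convert this using 2
      push_cast; ring

/-- `inPQ k i cs ∈ inP … i cs`. [folklore] -/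
theorem mem_inP (S : ℕ) (k : ℕ) : ∀ (cs : List ℚ) (i : ℕ), MI.mem S ((inPQ k i cs : ℚ) : ℝ) (inP S k i cs)
  | [], i => by simpa [inP, inPQ] using MI.mem_ofInt S 0
  | c :: cs, i => by
      rw [inP, inPQ_cons]
      have ih := mem_inP S k cs (i + 1)
      have h1 := mem_termP S c (i + k + 1) (Nat.succ_pos _)
      have := MI.mem_add h1 ih
      convert this using 2
      push_cast; ring

/-- `WN_k = 2 r_k X^{k+1} · Σ_i r_i X^i/(i+k+1)` as an interval. [folklore] -/
def wnMI (S : ℕ) (k : ℕ) : MI := scaleQ (inN X S k 0 1 1 r) (2 * r.getD k 0 * X ^ (k + 1))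

/-- `WP_k = 2 r_k · Σ_j r_j/(k+j+1)` as an interval. [folklore] -/
def wpMI (S : ℕ) (k : ℕ) : MI := scaleQ (inP S k 0 r) (2 * r.getD k 0)

/-- `WN_k` factored. [folklore] -/
theorem WN_eq_inNQ (k : ℕ) : WN r X k = (2 * r.getD k 0 * X ^ (k + 1)) * inNQ X k 0 r := by
  unfold WN inNQ qcoef
  rw [Finset.mul_sum]
  refine Finset.sum_congr rfl fun i _ => ?_
  simp only [zero_add, Nat.cast_zero]
  rw [show X ^ (i + k + 1) = X ^ i * X ^ (k + 1) by rw [← pow_add, add_assoc]]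
  have : ((i : ℚ) + k + 1) ≠ 0 := by positivity
  field_simp

/-- `WP_k` factored. [folklore] -/
theorem WP_eq_inPQ (k : ℕ) : WP r k = (2 * r.getD k 0) * inPQ k 0 r := by
  unfold WP inPQ qcoef
  rw [Finset.mul_sum]
  refine Finset.sum_congr rfl fun j _ => ?_
  simp only [zero_add, Nat.cast_zero]
  have : ((k : ℚ) + j + 1) ≠ 0 := by positivity
  have : ((j : ℚ) + k + 1) ≠ 0 := by positivity
  field_simp
  ring

/-- `WN_k ∈ wnMI`. [folklore] -/
theorem mem_wnMI (S : ℕ) (k : ℕ) : MI.mem S ((WN r X k : ℚ) : ℝ) (wnMI r X S k) := by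
  have h := mem_scaleQ (mem_inN X S k r 0) (2 * r.getD k 0 * X ^ (k + 1))
  simp only [pow_zero] at h
  unfold wnMI
  rw [WN_eq_inNQ]
  convert h using 2
  push_cast; ring

/-- `WP_k ∈ wpMI`. [folklore] -/
theorem mem_wpMI (S : ℕ) (k : ℕ) : MI.mem S ((WP r k : ℚ) : ℝ) (wpMI r S k) := by
  have h := mem_scaleQ (mem_inP S k r 0) (2 * r.getD k 0)
  unfold wpMI
  rw [WP_eq_inPQ]
  convert h using 2
  push_cast; ring

end Summit.RiemannHypothesis.RiemannHypothesis.SoninPoly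

end
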